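import Literature.Topology.FourManifolds.TrisectionFunctorGKStabilization
import HarnessLib

/-!
# Stabilisation compatibility of the Abrams–Gay–Kirby functor: the kernel computation behind
# the geometric half of fact (c′)

Topic `Literature/Topology/FourManifolds`; second sibling of `TrisectionFunctorGK.lean` for the
fact seat `provefact-Literature.Topology.FourManifolds.exists-14560f9fc8` (named fact (c′)
`Literature.Topology.FourManifolds.exists_stabilized_gkTrisection`; its algebraic half —
invariance of `TrisectionKernels.stabilize` under liftable automorphisms and the glue
`exists_stabilized_gkTrisection_of_geometric_of_nielsen` — is `TrisectionFunctorGKStabilization.lean`).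

## What this file proves (sorry-free, theorems only, no definitions, no named facts)

The *geometric half* of (c′) (Gay–Kirby 2016, Def. 8 and Lemma 10; Abrams–Gay–Kirby 2018, Def. 3
and Thm. 5, proof p. 1542: "The connected sum operation and the `(3,1)`–trisection on the group
side are constructed exactly to correspond to stabilization of manifolds via the map `ℳ`")
ends with a computation of fundamental groups.  After the three boundary-parallel arcs have been
drilled out of the handlebodies `H_{ij}` inside a small ball around a point `p` of the central
surface `F` (Gay–Kirby, Def. 8: `X₁′ = (X₁ ∪ N₂₃) ∖ (N̊₃₁ ∪ N̊₁₂)` etc.), the new central surface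
and the new handlebodies decompose as

* `F′ = A ∪_C P`, `A = F ∖ D̊` (`D ⊆ F` a disc containing the six arc ends, `C = ∂D`),
  `P = (D ∖ six discs) ∪ three tubes ≅ Σ₃ ∖ disc`, so that by Seifert–van Kampen `π₁(F′, c₀)`
  (`c₀ ∈ C`) is the pushout of `π₁(A) = F⟨a₁, …, b_g⟩ ← π₁(C) = ℤ → π₁(P) = F⟨a₁′, …, b₃′⟩`, the
  circle reading `r_g = ∏[aᵢ, bᵢ]` in `A` and `(r₃′)⁻¹` in `P`;
* `H′ᵢ = A^H ∪_E B^H` with `A^H = Hᵢ ∖ (half-ball) ⊇ A`, `B^H ⊇ P` a genus-`3` chunk and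
  `E = A^H ∩ B^H` a disc, so that `π₁(H′ᵢ) = π₁(A^H) ∗ π₁(B^H)` (van Kampen, free-product form),
  where `π₁(A) ↠ π₁(A^H) = π₁(Hᵢ)` has kernel the full preimage `K̂ᵢ` of the old kernel
  `Kᵢ ⊆ S_g` and `π₁(P) ↠ π₁(B^H) = F₃` has kernel the full preimage `L̂ᵢ` of the `i`-th kernel
  of the genus-`3` trisection of `S⁴` (`s4Kernels`: the cut systems `(λ₁₂, m₃₁, m₂₃)`, … of the
  three tubes).

This file supplies, once and for all, the **group theory that turns such van Kampen data into
the statement `𝒢(h′, x₀′, μ′) = (𝒢(h, x₀, μ₀)).stabilize` on the nose**: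

* `surfaceGroup_hom_ext_add_three`, `surfaceGroup_exists_hom_add_three` — **`S_{g+3}` is the
  pushout of `F⟨a₁,…,b_g⟩ ← ℤ → F⟨a₁,…,b₃⟩`** (`1 ↦ r_g`, `1 ↦ r₃⁻¹`): a pair of homomorphisms
  `u`, `v` out of the two free groups with `u(r_g) · v(r₃) = 1` extends uniquely along
  `ι = mk ∘ genIncl`, `σ = mk ∘ genShift` (`r_{g+3} = ι r_g · σ r₃`, `surfaceRelator_add_three`);
* `surfaceGroup_exists_mulEquiv_of_pushout` — hence any other pushout `(Γ; u, v)` of the same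
  span (existence of the comparison map into `S_{g+3}` and uniqueness of endomorphisms of `Γ`
  on `u`, `v`) is isomorphic to `S_{g+3}` compatibly with `ι`, `σ`: **the marking `μ′` of the
  stabilised central surface**;
* `ker_eq_normalClosure_of_coprod_of_surjective` — **kernel of a map from a group generated by
  two subgroups to a free product, induced by two surjections**: if `Γ = ⟨u(A) ∪ v(B)⟩`,
  `Λ ⊇ j_A(A′), j_B(B′)` has the universal property of the free product `A′ ∗ B′`, and
  `ρ ∘ u = j_A ∘ a`, `ρ ∘ v = j_B ∘ b` for surjections `a : A ↠ A′`, `b : B ↠ B′`, then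
  `ker ρ = ⟪u(ker a) ∪ v(ker b)⟫` (Hatcher, Thm. 1.20, kernel clause, in the form "pushout of two
  epimorphisms"; cf. the tree's `VanKampen.surjective_and_ker_eq_normalClosure_of_epi`);
  `ker_eq_normalClosure_of_mulEquiv_coprod_of_surjective` is the same with the free product given
  as an isomorphism `Λ ≃* A′ ∗ B′` (the output of the tree's `fundamentalGroupEquivCoprod`);
* `surfaceGroup_ker_eq_stabilize` — specialised to `Γ = S_{g+3}`, `u = ι`, `v = σ`,
  `ker a = mk⁻¹ Kᵢ`, `ker b = mk⁻¹ (s4Kernels i)`: **`ker ρ = K.stabilize i`** on the nose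
  (this is literally the definition of `TrisectionKernels.stabilize`, Abrams–Gay–Kirby Def. 2–3);
* `comap_mk_normalClosure_image`, `comap_mk_s4Kernels`, `preimage_mk_s4Kernels` — pulled back to
  the free group, "normally generated by the cut curves" becomes "normally generated by the cut
  curves and the seam circle `r₃`" (the form in which the kernel of
  `π₁(Σ₃ ∖ disc) → π₁(genus-3 chunk)` is computed); `mk_genIncl_surfaceRelator_mul_mk_genShift`
  — the seam compatibility `ι(r_g) · σ(r₃) = 1`;
* `surfaceGroup_exists_mulEquiv_of_surjective`, `surfaceGroup_exists_mulEquiv_of_basis_of_surjective`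
  — **the geometric marking `μ₀`**: a free basis of `π₁(F ∖ D̊, c₀)` in which the boundary circle
  reads `r_g`, followed by the (surjective, kernel `⟪[∂D]⟫`: Hatcher Prop. 1.26) map to
  `π₁(F, c₀)`, induces `S_g ≃* π₁(F, c₀)`; `ker_comp_coe_eq_preimage_comap` — the old kernel
  `Kᵢ = 𝒢(h, c₀, μ₀) i` read on `π₁(F ∖ D̊) → π₁(Hᵢ ∖ half-ball) ↪ π₁(Hᵢ)`;
* `groupGKTrisectionOf_apply_eq_stabilize_of_coprod`, `groupGKTrisectionOf_eq_stabilize_of_coprod`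
  — **packaging for (c′)**: for a Gay–Kirby trisection `S′` of type `(g+3, k′)` with marking
  `μ′ : S_{g+3} ≃* π₁(F′, x₀′)`, if for each `i` the map `π₁(F′) → π₁(H′ᵢ)` composed with `μ′`
  factors through a free product of two quotients of the free groups with kernels `mk⁻¹ Kᵢ` and
  `mk⁻¹ (s4Kernels i)` as above, then `groupGKTrisectionOf h′ x₀′ μ′ = K.stabilize`; with
  `K = 𝒢(h, x₀, μ₀)` this is exactly the hypothesis `hgeom` of
  `exists_stabilized_gkTrisection_of_lift` / `…_of_geometric_of_nielsen`
  (`exists_iso_stabilize_of_eq`); `groupGKTrisectionOf_apply_eq_stabilize_of_pieces` — the same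
  slot-wise statement with every hypothesis an inclusion-induced map between fundamental groups of
  the pieces `A ⊆ F, F′`, `A ⊆ A^H ⊆ Hᵢ, H′ᵢ`, `P ⊆ F′`, `P ⊆ B^H ⊆ H′ᵢ` (the precise list of `π₁`
  inputs the geometric construction must deliver).

What remains GEOMETRIC (and is not touched here): the construction of `S′` over
`IsBalancedGKTrisection` (new straightened sectors with corner charts along `F′` and Morse
functions with `1 + (k+1)` critical points, new handlebodies with `1 + (g+3)`), and the van
Kampen inputs themselves (free bases of `π₁(F ∖ D̊)` and `π₁(P)` in which the seam circle reads
`r_g`, `r₃⁻¹`; `π₁(Hᵢ ∖ half-ball) = π₁(Hᵢ)`; the three cut systems of the genus-`3` chunks).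
(c′) stays a named fact.

## References

* A. Abrams, D. Gay, R. Kirby, *Group trisections and smooth 4-manifolds*, Geom. Topol. 22 (2018)
  1537–1545: Def. 2 (connected sum of group trisections, generator-wise), Def. 3 (stabilisation =
  connected sum with the standard trivial `(3,1)`-trisection), Thm. 5 and its proof (p. 1542).
  [AbramsGayKirby2018]
* D. Gay, R. Kirby, *Trisecting 4-manifolds*, Geom. Topol. 20 (2016) 3097–3132: Def. 8
  (stabilisation by drilling three boundary-parallel arcs), Lemma 10 (p. 3100). [GayKirby2016]
* A. Hatcher, *Algebraic Topology*, CUP (2002), §1.2, Thm. 1.20 (Seifert–van Kampen; the kernel is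
  normally generated by the `i_{αβ}(ω) i_{βα}(ω)⁻¹`). [HatcherAT2002]
-/

noncomputable section

open Set Subgroup Monoid Monoid.Coprod

namespace Literature.Topology.FourManifolds

universe u

/-! ### `S_{g+3}` is the pushout of `F⟨a₁, …, b_g⟩ ← ℤ → F⟨a₁, …, b₃⟩` -/

section Pushout

variable {g : ℕ}

/-- **Uniqueness.**  Two homomorphisms out of `S_{g+3}` agreeing on the first `g` handles
(`ι = mk ∘ genIncl`) and on the last three (`σ = mk ∘ genShift`) are equal. [folklore] -/
theorem surfaceGroup_hom_ext_add_three {M : Type*} [Monoid M]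
    {φ χ : SurfaceGroup (g + 3) →* M}
    (h₁ : φ.comp ((PresentedGroup.mk _).comp (genIncl g)) =
      χ.comp ((PresentedGroup.mk _).comp (genIncl g)))
    (h₂ : φ.comp ((PresentedGroup.mk _).comp (genShift g)) =
      χ.comp ((PresentedGroup.mk _).comp (genShift g))) :
    φ = χ := by
  have h : φ.comp (PresentedGroup.mk _) = χ.comp (PresentedGroup.mk _) :=
    freeGroup_hom_ext_genIncl_genShift
      (by rw [MonoidHom.comp_assoc, MonoidHom.comp_assoc]; exact h₁)
      (by rw [MonoidHom.comp_assoc, MonoidHom.comp_assoc]; exact h₂)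
  refine MonoidHom.ext fun x => ?_
  obtain ⟨x, rfl⟩ := PresentedGroup.mk_surjective _ x
  exact DFunLike.congr_fun h x

/-- **Existence.**  Homomorphisms `u : F⟨a₁, …, b_g⟩ → T` and `v : F⟨a₁, …, b₃⟩ → T` with
`u(r_g) · v(r₃) = 1` extend to a homomorphism `m : S_{g+3} → T` with `m ∘ ι = u`, `m ∘ σ = v`
(the free extension kills `r_{g+3} = ι(r_g) · σ(r₃)`, `surfaceRelator_add_three`).  Together with
`surfaceGroup_hom_ext_add_three`: `S_{g+3}` is the pushout (amalgamated free product) of the two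
free groups over `ℤ`, `1 ↦ r_g`, `1 ↦ r₃⁻¹` — the presentation of `π₁` of a genus-`(g+3)` surface
cut along a circle separating `g` handles from `3`. [folklore] -/
theorem surfaceGroup_exists_hom_add_three {T : Type*} [Group T]
    (u : FreeGroup (surfaceGen g) →* T) (v : FreeGroup (surfaceGen 3) →* T)
    (huv : u (surfaceRelator g) * v (surfaceRelator 3) = 1) :
    ∃ m : SurfaceGroup (g + 3) →* T,
      m.comp ((PresentedGroup.mk _).comp (genIncl g)) = u ∧
        m.comp ((PresentedGroup.mk _).comp (genShift g)) = v := by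
  let E : FreeGroup (surfaceGen (g + 3)) →* T := FreeGroup.lift fun p =>
    Fin.addCases (motive := fun _ => T) (fun i => u (FreeGroup.of (i, p.2)))
      (fun j => v (FreeGroup.of (j, p.2))) p.1
  have hE₁ : E.comp (genIncl g) = u := FreeGroup.ext_hom _ _ fun q => by simp [E]
  have hE₂ : E.comp (genShift g) = v := FreeGroup.ext_hom _ _ fun q => by simp [E]
  have hEr : ∀ r ∈ ({surfaceRelator (g + 3)} : Set (FreeGroup (surfaceGen (g + 3)))), E r = 1 := by
    intro r hr
    rw [Set.mem_singleton_iff] at hr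
    rw [hr, surfaceRelator_add_three, map_mul, ← MonoidHom.comp_apply, hE₁, ← MonoidHom.comp_apply,
      hE₂, huv]
  refine ⟨presentedLift E hEr, ?_, ?_⟩
  · rw [← hE₁]
    exact MonoidHom.ext fun x => by simp
  · rw [← hE₂]
    exact MonoidHom.ext fun x => by simp

/-- **Any pushout of `F⟨a₁,…,b_g⟩ ← ℤ → F⟨a₁,…,b₃⟩` (`1 ↦ r_g`, `1 ↦ r₃⁻¹`) is `S_{g+3}`.**  Let
`u : F⟨a₁,…,b_g⟩ → Γ`, `v : F⟨a₁,…,b₃⟩ → Γ` with `u(r_g) · v(r₃) = 1` be such that (existence)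
some `F : Γ → S_{g+3}` has `F ∘ u = ι`, `F ∘ v = σ`, and (uniqueness) endomorphisms of `Γ`
agreeing on `u` and on `v` are equal — both hold when `(Γ; u, v)` has the universal property of
the pushout, e.g. `Γ = π₁(F′)` for the stabilised central surface `F′ = (F ∖ D̊) ∪_C (Σ₃ ∖ D̊)`
by Seifert–van Kampen with free bases of the two sides in which the seam circle reads `r_g` and
`r₃⁻¹`.  Then there is an isomorphism `e : S_{g+3} ≃* Γ` with `e ∘ ι = u` and `e ∘ σ = v`: the
marking of the stabilised central surface. [cite: HatcherAT2002, Thm. 1.20] -/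
theorem surfaceGroup_exists_mulEquiv_of_pushout {Γ : Type*} [Group Γ]
    (u : FreeGroup (surfaceGen g) →* Γ) (v : FreeGroup (surfaceGen 3) →* Γ)
    (huv : u (surfaceRelator g) * v (surfaceRelator 3) = 1)
    (hexists : ∃ F : Γ →* SurfaceGroup (g + 3),
      F.comp u = (PresentedGroup.mk _).comp (genIncl g) ∧
        F.comp v = (PresentedGroup.mk _).comp (genShift g))
    (hunique : ∀ F F' : Γ →* Γ, F.comp u = F'.comp u → F.comp v = F'.comp v → F = F') :
    ∃ e : SurfaceGroup (g + 3) ≃* Γ,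
      e.toMonoidHom.comp ((PresentedGroup.mk _).comp (genIncl g)) = u ∧
        e.toMonoidHom.comp ((PresentedGroup.mk _).comp (genShift g)) = v := by
  obtain ⟨m, hm₁, hm₂⟩ := surfaceGroup_exists_hom_add_three u v huv
  obtain ⟨F, hF₁, hF₂⟩ := hexists
  have h1 : F.comp m = MonoidHom.id _ := by
    refine surfaceGroup_hom_ext_add_three ?_ ?_
    · rw [MonoidHom.comp_assoc, hm₁, hF₁, MonoidHom.id_comp]
    · rw [MonoidHom.comp_assoc, hm₂, hF₂, MonoidHom.id_comp]
  have h2 : m.comp F = MonoidHom.id _ := by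
    refine hunique _ _ ?_ ?_
    · rw [MonoidHom.comp_assoc, hF₁, hm₁, MonoidHom.id_comp]
    · rw [MonoidHom.comp_assoc, hF₂, hm₂, MonoidHom.id_comp]
  exact ⟨MonoidHom.toMulEquiv m F h1 h2, hm₁, hm₂⟩

/-- `S_{g+3}` is generated by the images of `ι = mk ∘ genIncl` and `σ = mk ∘ genShift`. [folklore] -/
theorem surfaceGroup_closure_range_union_eq_top :
    Subgroup.closure (Set.range ((PresentedGroup.mk _).comp (genIncl g)) ∪
      Set.range ((PresentedGroup.mk _).comp (genShift g))) = (⊤ : Subgroup (SurfaceGroup (g + 3))) := by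
  rw [eq_top_iff, ← PresentedGroup.closure_range_of, Subgroup.closure_le]
  rintro _ ⟨p, rfl⟩
  refine Subgroup.subset_closure ?_
  rcases of_eq_genIncl_or_genShift p with ⟨q, hq⟩ | ⟨q, hq⟩
  · refine Or.inl ⟨FreeGroup.of q, ?_⟩
    change PresentedGroup.mk _ (genIncl g (FreeGroup.of q)) = _
    rw [← hq]
    rfl
  · refine Or.inr ⟨FreeGroup.of q, ?_⟩
    change PresentedGroup.mk _ (genShift g (FreeGroup.of q)) = _
    rw [← hq]
    rfl

end Pushout

/-! ### Kernel of a map to a free product induced by two surjections -/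

section CoprodKernel

variable {Γ : Type u} {Λ A B A' B' : Type*} [Group Γ] [Group Λ] [Group A] [Group B]
  [Group A'] [Group B']

/-- **Kernel of a map from a group generated by two subgroups to a free product, induced by two
surjections.**  Let `Γ` be generated by `u(A) ∪ v(B)`, let `j_A : A′ → Λ`, `j_B : B′ → Λ` have
the (existence half of the) universal property of the free product `A′ ∗ B′` for targets in the
universe of `Γ`, and let `ρ : Γ → Λ` satisfy `ρ ∘ u = j_A ∘ a`, `ρ ∘ v = j_B ∘ b` for SURJECTIVE
`a : A ↠ A′`, `b : B ↠ B′`.  Then `ker ρ` is the normal closure of `u(ker a) ∪ v(ker b)`.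
Proof (Hatcher's argument for the kernel in Thm. 1.20, epimorphic case): `⊇` is clear; for `⊆`
let `N` be that normal closure and factor `Γ → Γ/N` through `a` and `b`
(`MonoidHom.liftOfSurjective`), assemble `Φ : Λ → Γ/N` by the universal property, and note
`Φ ∘ ρ = (Γ → Γ/N)` on the generators `u(A) ∪ v(B)`.  In the application `Γ = π₁(F′)` is the
pushout over the seam circle, `Λ = π₁(H′ᵢ) = π₁(Hᵢ ∖ half-ball) ∗ π₁(genus-3 chunk)` (van Kampen
along a disc), `a`, `b` are induced by the inclusions of the two halves of `F′`.
[cite: HatcherAT2002, Thm. 1.20] -/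
theorem ker_eq_normalClosure_of_coprod_of_surjective
    (u : A →* Γ) (v : B →* Γ) (hgen : Subgroup.closure (Set.range u ∪ Set.range v) = ⊤)
    (ρ : Γ →* Λ) (jA : A' →* Λ) (jB : B' →* Λ)
    (hcop : ∀ (T : Type u) [Group T] (f : A' →* T) (f' : B' →* T),
      ∃ Φ : Λ →* T, Φ.comp jA = f ∧ Φ.comp jB = f')
    (a : A →* A') (b : B →* B') (ha : Function.Surjective a) (hb : Function.Surjective b)
    (hA : ρ.comp u = jA.comp a) (hB : ρ.comp v = jB.comp b) :
    ρ.ker = Subgroup.normalClosure (u '' (a.ker : Set A) ∪ v '' (b.ker : Set B)) := by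
  apply le_antisymm
  · set N := Subgroup.normalClosure (u '' (a.ker : Set A) ∪ v '' (b.ker : Set B)) with hN
    let q : Γ →* Γ ⧸ N := QuotientGroup.mk' N
    have hqA : a.ker ≤ (q.comp u).ker := by
      intro x hx
      rw [MonoidHom.mem_ker, MonoidHom.comp_apply, QuotientGroup.mk'_apply, QuotientGroup.eq_one_iff]
      exact Subgroup.subset_normalClosure (Or.inl ⟨x, hx, rfl⟩)
    have hqB : b.ker ≤ (q.comp v).ker := by
      intro x hx
      rw [MonoidHom.mem_ker, MonoidHom.comp_apply, QuotientGroup.mk'_apply, QuotientGroup.eq_one_iff]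
      exact Subgroup.subset_normalClosure (Or.inr ⟨x, hx, rfl⟩)
    let f : A' →* Γ ⧸ N := a.liftOfSurjective ha ⟨q.comp u, hqA⟩
    let f' : B' →* Γ ⧸ N := b.liftOfSurjective hb ⟨q.comp v, hqB⟩
    have hf : ∀ x, f (a x) = q (u x) := fun x =>
      a.liftOfRightInverse_comp_apply _ _ ⟨q.comp u, hqA⟩ x
    have hf' : ∀ y, f' (b y) = q (v y) := fun y =>
      b.liftOfRightInverse_comp_apply _ _ ⟨q.comp v, hqB⟩ y
    obtain ⟨Φ, hΦA, hΦB⟩ := hcop (Γ ⧸ N) f f'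
    have hΦρ : Φ.comp ρ = q := by
      refine MonoidHom.eq_of_eqOn_dense hgen ?_
      rintro _ (⟨x, rfl⟩ | ⟨y, rfl⟩)
      · change Φ (ρ (u x)) = q (u x)
        rw [← MonoidHom.comp_apply ρ u, hA, MonoidHom.comp_apply, ← MonoidHom.comp_apply Φ jA, hΦA,
          hf]
      · change Φ (ρ (v y)) = q (v y)
        rw [← MonoidHom.comp_apply ρ v, hB, MonoidHom.comp_apply, ← MonoidHom.comp_apply Φ jB, hΦB,
          hf']
    intro x hx
    rw [MonoidHom.mem_ker] at hx
    have hq : q x = 1 := by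
      rw [← hΦρ, MonoidHom.comp_apply, hx, map_one]
    rwa [QuotientGroup.mk'_apply, QuotientGroup.eq_one_iff] at hq
  · refine Subgroup.normalClosure_le_normal ?_
    rintro _ (⟨x, hx, rfl⟩ | ⟨y, hy, rfl⟩)
    · rw [SetLike.mem_coe, MonoidHom.mem_ker] at hx ⊢
      rw [← MonoidHom.comp_apply, hA, MonoidHom.comp_apply, hx, map_one]
    · rw [SetLike.mem_coe, MonoidHom.mem_ker] at hy ⊢
      rw [← MonoidHom.comp_apply, hB, MonoidHom.comp_apply, hy, map_one]

/-- The same kernel computation with the free product structure on `Λ` given by an isomorphism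
`e : Λ ≃* A′ ∗ B′` carrying `j_A`, `j_B` to the two canonical inclusions — the form produced by
the tree's free-product van Kampen theorem `fundamentalGroupEquivCoprod` (with
`fundamentalGroupEquivCoprod_inclHom_left/right`). [cite: HatcherAT2002, Thm. 1.20] -/
theorem ker_eq_normalClosure_of_mulEquiv_coprod_of_surjective
    (u : A →* Γ) (v : B →* Γ) (hgen : Subgroup.closure (Set.range u ∪ Set.range v) = ⊤)
    (ρ : Γ →* Λ) (jA : A' →* Λ) (jB : B' →* Λ) (e : Λ ≃* A' ∗ B')
    (heA : e.toMonoidHom.comp jA = Coprod.inl) (heB : e.toMonoidHom.comp jB = Coprod.inr)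
    (a : A →* A') (b : B →* B') (ha : Function.Surjective a) (hb : Function.Surjective b)
    (hA : ρ.comp u = jA.comp a) (hB : ρ.comp v = jB.comp b) :
    ρ.ker = Subgroup.normalClosure (u '' (a.ker : Set A) ∪ v '' (b.ker : Set B)) := by
  refine ker_eq_normalClosure_of_coprod_of_surjective u v hgen ρ jA jB ?_ a b ha hb hA hB
  intro T _ f f'
  refine ⟨(Coprod.lift f f').comp e.toMonoidHom, ?_, ?_⟩
  · rw [MonoidHom.comp_assoc, heA, Coprod.lift_comp_inl]
  · rw [MonoidHom.comp_assoc, heB, Coprod.lift_comp_inr]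

end CoprodKernel

/-! ### Specialisation to `S_{g+3}`: the kernel is the algebraic stabilisation -/

section SurfaceKernel

variable {g : ℕ} {Λ A' B' : Type*} [Group Λ] [Group A'] [Group B']

/-- **The kernel is `stabilize` on the nose.**  Let `ρ : S_{g+3} → Λ` factor on the first `g`
handles as `ρ ∘ ι = j_A ∘ a` and on the last three as `ρ ∘ σ = j_B ∘ b`, where `j_A`, `j_B`
present `Λ` as a free product `A′ ∗ B′` (existence half of the universal property), and
`a : F⟨a₁,…,b_g⟩ ↠ A′`, `b : F⟨a₁,…,b₃⟩ ↠ B′` are surjections whose kernels are the full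
preimages of `Kᵢ ⊆ S_g` and of the `i`-th `S⁴` kernel `s4Kernels i ⊆ S₃`.  Then
`ker ρ = K.stabilize i` — by definition of `TrisectionKernels.stabilize` (Abrams–Gay–Kirby,
Def. 2–3: the kernels of a connected sum are generated by those of the summands, generator-wise)
and `ker_eq_normalClosure_of_coprod_of_surjective`.  In the application `Λ = π₁(H′ᵢ)`,
`A′ = π₁(Hᵢ ∖ half-ball) = π₁(Hᵢ)`, `B′ = π₁` of the genus-`3` chunk.
[cite: AbramsGayKirby2018, Def. 2–3 (pp. 1539–1540)] -/
theorem surfaceGroup_ker_eq_stabilize (K : TrisectionKernels g) (i : Fin 3)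
    (ρ : SurfaceGroup (g + 3) →* Λ) (jA : A' →* Λ) (jB : B' →* Λ)
    (hcop : ∀ (T : Type) [Group T] (f : A' →* T) (f' : B' →* T),
      ∃ Φ : Λ →* T, Φ.comp jA = f ∧ Φ.comp jB = f')
    (a : FreeGroup (surfaceGen g) →* A') (b : FreeGroup (surfaceGen 3) →* B')
    (ha : Function.Surjective a) (hb : Function.Surjective b)
    (hka : (a.ker : Set (FreeGroup (surfaceGen g))) = PresentedGroup.mk _ ⁻¹' (K i : Set (SurfaceGroup g)))
    (hkb : (b.ker : Set (FreeGroup (surfaceGen 3))) =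
      PresentedGroup.mk _ ⁻¹' (s4Kernels i : Set (SurfaceGroup 3)))
    (hA : ρ.comp ((PresentedGroup.mk _).comp (genIncl g)) = jA.comp a)
    (hB : ρ.comp ((PresentedGroup.mk _).comp (genShift g)) = jB.comp b) :
    ρ.ker = K.stabilize i := by
  rw [ker_eq_normalClosure_of_coprod_of_surjective _ _ surfaceGroup_closure_range_union_eq_top ρ jA jB
    hcop a b ha hb hA hB, hka, hkb, TrisectionKernels.stabilize_apply]
  rfl

/-- The same with the free product structure on `Λ` given by an isomorphism `e : Λ ≃* A′ ∗ B′`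
carrying `j_A`, `j_B` to the canonical inclusions. [cite: AbramsGayKirby2018, Def. 2–3 (pp. 1539–1540)] -/
theorem surfaceGroup_ker_eq_stabilize_of_mulEquiv (K : TrisectionKernels g) (i : Fin 3)
    (ρ : SurfaceGroup (g + 3) →* Λ) (jA : A' →* Λ) (jB : B' →* Λ) (e : Λ ≃* A' ∗ B')
    (heA : e.toMonoidHom.comp jA = Coprod.inl) (heB : e.toMonoidHom.comp jB = Coprod.inr)
    (a : FreeGroup (surfaceGen g) →* A') (b : FreeGroup (surfaceGen 3) →* B')
    (ha : Function.Surjective a) (hb : Function.Surjective b)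
    (hka : (a.ker : Set (FreeGroup (surfaceGen g))) = PresentedGroup.mk _ ⁻¹' (K i : Set (SurfaceGroup g)))
    (hkb : (b.ker : Set (FreeGroup (surfaceGen 3))) =
      PresentedGroup.mk _ ⁻¹' (s4Kernels i : Set (SurfaceGroup 3)))
    (hA : ρ.comp ((PresentedGroup.mk _).comp (genIncl g)) = jA.comp a)
    (hB : ρ.comp ((PresentedGroup.mk _).comp (genShift g)) = jB.comp b) :
    ρ.ker = K.stabilize i := by
  refine surfaceGroup_ker_eq_stabilize K i ρ jA jB ?_ a b ha hb hka hkb hA hB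
  intro T _ f f'
  refine ⟨(Coprod.lift f f').comp e.toMonoidHom, ?_, ?_⟩
  · rw [MonoidHom.comp_assoc, heA, Coprod.lift_comp_inl]
  · rw [MonoidHom.comp_assoc, heB, Coprod.lift_comp_inr]

end SurfaceKernel

/-! ### Preimages in the free group: kernels "normally generated by curves" -/

section Preimage

variable {n : ℕ}

/-- `ι(r_g) · σ(r₃) = 1` in `S_{g+3}` (`r_{g+3} = ι r_g · σ r₃`): the compatibility on the seam
circle needed to map the van Kampen pushout `π₁(F′)` to `S_{g+3}` (the circle reads `r_g` on
the side of the old surface and `r₃⁻¹` on the side of the three new handles). [folklore] -/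
theorem mk_genIncl_surfaceRelator_mul_mk_genShift (g : ℕ) :
    PresentedGroup.mk ({surfaceRelator (g + 3)} : Set (FreeGroup (surfaceGen (g + 3))))
        (genIncl g (surfaceRelator g)) *
      PresentedGroup.mk ({surfaceRelator (g + 3)} : Set (FreeGroup (surfaceGen (g + 3))))
        (genShift g (surfaceRelator 3)) = 1 := by
  rw [← map_mul, ← surfaceRelator_add_three, PresentedGroup.mk_eq_one_iff]
  exact subset_normalClosure rfl

/-- **Pulling a normal closure back to the free group.**  For words `T` in the free group on the
surface generators, the preimage under `F⟨a₁,…,b_n⟩ ↠ S_n` of the normal closure of their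
classes is the normal closure of `T ∪ {r_n}`.  (So "the kernel of `π₁(∂H ∖ disc) → π₁ H` is
normally generated by the cut curves and the boundary circle" is the free-group form of "the
kernel of `π₁(∂H) → π₁ H` is normally generated by the cut curves".) [folklore] -/
theorem comap_mk_normalClosure_image (T : Set (FreeGroup (surfaceGen n))) :
    (normalClosure ((PresentedGroup.mk ({surfaceRelator n} : Set (FreeGroup (surfaceGen n)))) '' T)).comap
        (PresentedGroup.mk ({surfaceRelator n} : Set (FreeGroup (surfaceGen n)))) =
      normalClosure (T ∪ {surfaceRelator n}) := by
  apply le_antisymm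
  · intro x hx
    rw [Subgroup.mem_comap, ← map_normalClosure _ _ (PresentedGroup.mk_surjective _),
      Subgroup.mem_map] at hx
    obtain ⟨y, hy, hyx⟩ := hx
    have hker : y⁻¹ * x ∈ normalClosure ({surfaceRelator n} : Set (FreeGroup (surfaceGen n))) := by
      rw [← PresentedGroup.mk_eq_one_iff, map_mul, map_inv, hyx, inv_mul_cancel]
    have hx' : x = y * (y⁻¹ * x) := by group
    rw [hx']
    exact mul_mem (normalClosure_mono Set.subset_union_left hy)
      (normalClosure_mono Set.subset_union_right hker)
  · refine normalClosure_le_normal ?_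
    rintro x (hx | hx)
    · exact subset_normalClosure ⟨x, hx, rfl⟩
    · rw [Set.mem_singleton_iff] at hx
      subst hx
      have h1 : PresentedGroup.mk ({surfaceRelator n} : Set (FreeGroup (surfaceGen n)))
          (surfaceRelator n) = 1 :=
        (PresentedGroup.mk_eq_one_iff).mpr (subset_normalClosure (Set.mem_singleton _))
      rw [SetLike.mem_coe, Subgroup.mem_comap, h1]
      exact one_mem _

/-- The `S⁴` side: the preimage in `F⟨a₁, …, b₃⟩` of the `i`-th kernel of the genus-`3`
trisection of `S⁴` is the normal closure of its three cut-curve generators (`s4Gens i`: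
`{a₁,a₂,b₃}`, `{a₁,b₂,a₃}`, `{b₁,a₂,a₃}`) and the relator `r₃`.  This is the form in which the
geometric side delivers the kernel of `π₁(Σ₃ ∖ disc) → π₁(genus-3 chunk)`: normally generated by
the three cut curves and the seam circle. [cite: GayKirby2016, §1 (genus-3 trisection of S⁴)] -/
theorem comap_mk_s4Kernels (i : Fin 3) :
    (s4Kernels i).comap (PresentedGroup.mk ({surfaceRelator 3} : Set (FreeGroup (surfaceGen 3)))) =
      normalClosure (FreeGroup.of '' (s4Gens i : Set (surfaceGen 3)) ∪ {surfaceRelator 3}) := by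
  rw [s4Kernels_eq, ← comap_mk_normalClosure_image, Set.image_image]
  rfl

/-- Set form of `comap_mk_s4Kernels` (the shape of the hypothesis `hkb` below). [folklore] -/
theorem preimage_mk_s4Kernels (i : Fin 3) :
    (PresentedGroup.mk ({surfaceRelator 3} : Set (FreeGroup (surfaceGen 3)))) ⁻¹'
        (s4Kernels i : Set (SurfaceGroup 3)) =
      (normalClosure (FreeGroup.of '' (s4Gens i : Set (surfaceGen 3)) ∪ {surfaceRelator 3}) :
        Set (FreeGroup (surfaceGen 3))) := by
  rw [← comap_mk_s4Kernels, Subgroup.coe_comap]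

end Preimage

/-! ### Markings from a disc decomposition of the central surface -/

section Marking

variable {n : ℕ}

/-- **A surjection from the free group with kernel `⟪r_n⟫` is a marking.**  If
`φ : F⟨a₁, …, b_n⟩ ↠ Γ` is onto with kernel the normal closure of the surface relator, it induces
an isomorphism `μ : S_n ≃* Γ` with `μ [x] = φ x`.  In the application `Γ = π₁(F, c₀)` and `φ` is
a free basis of `π₁(F ∖ D̊, c₀)` (in which the boundary circle reads `r_n`) followed by the map
induced by the inclusion, which is onto with kernel `⟪[∂D]⟫` by cell attachment (Hatcher,
Prop. 1.26 (a)): the *geometric marking* `μ₀` of the original central surface.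
[cite: HatcherAT2002, §1.2 p. 51 and Prop. 1.26] -/
theorem surfaceGroup_exists_mulEquiv_of_surjective {Γ : Type*} [Group Γ]
    (φ : FreeGroup (surfaceGen n) →* Γ) (hφ : Function.Surjective φ)
    (hker : φ.ker = normalClosure {surfaceRelator n}) :
    ∃ μ : SurfaceGroup n ≃* Γ,
      μ.toMonoidHom.comp (PresentedGroup.mk ({surfaceRelator n} : Set (FreeGroup (surfaceGen n)))) = φ := by
  have h1 : ∀ r ∈ ({surfaceRelator n} : Set (FreeGroup (surfaceGen n))), φ r = 1 := fun r hr => by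
    rw [← MonoidHom.mem_ker, hker]
    exact subset_normalClosure hr
  refine ⟨MulEquiv.ofBijective (presentedLift φ h1) ⟨?_, ?_⟩, MonoidHom.ext fun x => by simp⟩
  · rw [← MonoidHom.ker_eq_bot_iff, eq_bot_iff]
    intro x hx
    obtain ⟨x, rfl⟩ := PresentedGroup.mk_surjective _ x
    rw [MonoidHom.mem_ker, presentedLift_mk, ← MonoidHom.mem_ker, hker] at hx
    rw [Subgroup.mem_bot, PresentedGroup.mk_eq_one_iff]
    exact hx
  · intro y
    obtain ⟨x, rfl⟩ := hφ y
    exact ⟨PresentedGroup.mk _ x, presentedLift_mk _ _ _⟩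

/-- The same with the surjection factored as a free basis `θ : F⟨a₁,…,b_n⟩ ≃* Γ_A` of
`Γ_A = π₁(F ∖ D̊, c₀)` followed by `incl : Γ_A ↠ Γ = π₁(F, c₀)` with kernel `⟪θ(r_n)⟫`
(`θ(r_n)` = the class of the boundary circle). [cite: HatcherAT2002, §1.2 p. 51 and Prop. 1.26] -/
theorem surfaceGroup_exists_mulEquiv_of_basis_of_surjective {ΓA Γ : Type*} [Group ΓA] [Group Γ]
    (θ : FreeGroup (surfaceGen n) ≃* ΓA) (incl : ΓA →* Γ) (hincl : Function.Surjective incl)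
    (hker : incl.ker = normalClosure {θ (surfaceRelator n)}) :
    ∃ μ : SurfaceGroup n ≃* Γ,
      μ.toMonoidHom.comp (PresentedGroup.mk ({surfaceRelator n} : Set (FreeGroup (surfaceGen n)))) =
        incl.comp θ.toMonoidHom := by
  refine surfaceGroup_exists_mulEquiv_of_surjective _ (hincl.comp θ.surjective) ?_
  have hmap : (normalClosure ({surfaceRelator n} : Set (FreeGroup (surfaceGen n)))).map θ.toMonoidHom =
      normalClosure {θ (surfaceRelator n)} := by
    rw [map_normalClosure _ _ θ.surjective, MulEquiv.coe_toMonoidHom, Set.image_singleton]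
  ext x
  rw [MonoidHom.mem_ker, MonoidHom.comp_apply, MulEquiv.coe_toMonoidHom, ← MonoidHom.mem_ker, hker,
    ← hmap, Subgroup.mem_map_equiv, MulEquiv.symm_apply_apply]

end Marking

/-! ### Kernels read through intermediate pieces -/

section Pieces

variable {n : ℕ}

/-- **The old side.**  Let `μ₀ : S_n ≃* Γ_F` be a marking of `π₁(F, c₀)` which on words is a
homomorphism `θ : F⟨a₁,…,b_n⟩ → Γ_A = π₁(A, c₀)` (`A = F ∖ D̊`) followed by the inclusion-induced
`Γ_A → Γ_F`; let `ρ_F : Γ_F → Γ_H` (`π₁(F) → π₁(Hᵢ)`), `ρ_A : Γ_A → Γ_{AH}`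
(`π₁(A) → π₁(Hᵢ ∖ half-ball)`) and an INJECTIVE `j : Γ_{AH} → Γ_H` (removing a half-ball at the
boundary does not change `π₁`) with `j ∘ ρ_A = ρ_F ∘ incl`.  Then the kernel of `ρ_A ∘ θ` is the
full preimage of `μ₀⁻¹(ker ρ_F)` — the shape of the hypothesis `hka` below with
`Kᵢ = 𝒢(h, c₀, μ₀) i`. [folklore] -/
theorem ker_comp_coe_eq_preimage_comap {ΓA ΓF ΓAH ΓH : Type*} [Group ΓA] [Group ΓF] [Group ΓAH]
    [Group ΓH] (θ : FreeGroup (surfaceGen n) →* ΓA) (incl : ΓA →* ΓF) (μ₀ : SurfaceGroup n ≃* ΓF)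
    (hμ₀ : μ₀.toMonoidHom.comp (PresentedGroup.mk ({surfaceRelator n} : Set (FreeGroup (surfaceGen n)))) =
      incl.comp θ)
    (ρF : ΓF →* ΓH) (ρA : ΓA →* ΓAH) (j : ΓAH →* ΓH) (hj : Function.Injective j)
    (hsq : j.comp ρA = ρF.comp incl) :
    ((ρA.comp θ).ker : Set (FreeGroup (surfaceGen n))) =
      (PresentedGroup.mk ({surfaceRelator n} : Set (FreeGroup (surfaceGen n)))) ⁻¹'
        ((ρF.ker.comap μ₀.toMonoidHom : Subgroup (SurfaceGroup n)) : Set (SurfaceGroup n)) := by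
  ext x
  have h1 : μ₀ (PresentedGroup.mk _ x) = incl (θ x) := DFunLike.congr_fun hμ₀ x
  have h2 : j (ρA (θ x)) = ρF (incl (θ x)) := DFunLike.congr_fun hsq (θ x)
  simp only [SetLike.mem_coe, MonoidHom.mem_ker, MonoidHom.comp_apply, Set.mem_preimage,
    Subgroup.mem_comap, MulEquiv.coe_toMonoidHom]
  rw [h1, ← h2]
  exact (map_eq_one_iff j hj).symm

end Pieces

/-! ### Packaging for (c′): the kernel triple of the stabilised trisection -/

section Packaging

open scoped Manifold ContDiff

variable {X : Type u} [TopologicalSpace X] [ChartedSpace (EuclideanSpace ℝ (Fin 4)) X]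
  {g : ℕ} {k : Fin 3 → ℕ} {S' : Fin 3 → Set X}

/-- **One slot of `𝒢(h′, x₀′, μ′) = K.stabilize`.**  Let `S′` be a Gay–Kirby trisection of genus
`g + 3` with base point `x₀′` and marking `μ′ : S_{g+3} ≃* π₁(F′, x₀′)`, and fix `i`.  Suppose the
map `π₁(F′, x₀′) → π₁(H′ᵢ, x₀′)` induced by the inclusion of the central surface in the `i`-th
handlebody, precomposed with `μ′`, factors on the first `g` handles through a surjection
`a : F⟨a₁,…,b_g⟩ ↠ A′` with kernel `mk⁻¹ Kᵢ` and on the last three through a surjection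
`b : F⟨a₁,…,b₃⟩ ↠ B′` with kernel `mk⁻¹ (s4Kernels i)`, where `A′`, `B′` sit in `π₁(H′ᵢ, x₀′)` as
the two factors of a free product (van Kampen for `H′ᵢ = (Hᵢ ∖ half-ball) ∪_disc (genus-3 chunk)`,
Gay–Kirby Def. 8).  Then the `i`-th kernel of `𝒢(h′, x₀′, μ′)` is `K.stabilize i`.
[cite: AbramsGayKirby2018, Def. 3 (p. 1540) and Thm. 5 (p. 1541)] -/
theorem groupGKTrisectionOf_apply_eq_stabilize_of_coprod
    (h' : IsGKTrisection X (g + 3) k S') (x₀' : centralSurface S')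
    (μ' : SurfaceGroup (g + 3) ≃* FundamentalGroup (centralSurface S') x₀')
    (K : TrisectionKernels g) (i : Fin 3)
    {A' B' : Type*} [Group A'] [Group B']
    (jA : A' →* FundamentalGroup (handlebodyOpp S' i) (centralInclusion S' i x₀'))
    (jB : B' →* FundamentalGroup (handlebodyOpp S' i) (centralInclusion S' i x₀'))
    (hcop : ∀ (T : Type) [Group T] (f : A' →* T) (f' : B' →* T),
      ∃ Φ : FundamentalGroup (handlebodyOpp S' i) (centralInclusion S' i x₀') →* T,
        Φ.comp jA = f ∧ Φ.comp jB = f')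
    (a : FreeGroup (surfaceGen g) →* A') (b : FreeGroup (surfaceGen 3) →* B')
    (ha : Function.Surjective a) (hb : Function.Surjective b)
    (hka : (a.ker : Set (FreeGroup (surfaceGen g))) = PresentedGroup.mk _ ⁻¹' (K i : Set (SurfaceGroup g)))
    (hkb : (b.ker : Set (FreeGroup (surfaceGen 3))) =
      PresentedGroup.mk _ ⁻¹' (s4Kernels i : Set (SurfaceGroup 3)))
    (hA : ((FundamentalGroup.map (centralInclusion S' i) x₀').comp μ'.toMonoidHom).comp
      ((PresentedGroup.mk _).comp (genIncl g)) = jA.comp a)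
    (hB : ((FundamentalGroup.map (centralInclusion S' i) x₀').comp μ'.toMonoidHom).comp
      ((PresentedGroup.mk _).comp (genShift g)) = jB.comp b) :
    groupGKTrisectionOf h' x₀' μ' i = K.stabilize i := by
  rw [← surfaceGroup_ker_eq_stabilize K i _ jA jB hcop a b ha hb hka hkb hA hB]
  rfl

/-- **`𝒢(h′, x₀′, μ′) = K.stabilize` from slot-wise van Kampen data** (all three `i`).  With
`K = 𝒢(h, x₀, μ₀)` for a geometric marking `μ₀` of the original trisection this is the on-the-nose
form of the geometric half of (c′); `exists_iso_stabilize_of_eq` turns it into the hypothesis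
`hgeom` of `exists_stabilized_gkTrisection_of_lift`.
[cite: AbramsGayKirby2018, Def. 3 (p. 1540) and Thm. 5 (p. 1541)] -/
theorem groupGKTrisectionOf_eq_stabilize_of_coprod
    (h' : IsGKTrisection X (g + 3) k S') (x₀' : centralSurface S')
    (μ' : SurfaceGroup (g + 3) ≃* FundamentalGroup (centralSurface S') x₀')
    (K : TrisectionKernels g)
    (hslot : ∀ i : Fin 3, ∃ (A' B' : Type) (_ : Group A') (_ : Group B')
      (jA : A' →* FundamentalGroup (handlebodyOpp S' i) (centralInclusion S' i x₀'))
      (jB : B' →* FundamentalGroup (handlebodyOpp S' i) (centralInclusion S' i x₀'))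
      (a : FreeGroup (surfaceGen g) →* A') (b : FreeGroup (surfaceGen 3) →* B'),
      (∀ (T : Type) [Group T] (f : A' →* T) (f' : B' →* T),
        ∃ Φ : FundamentalGroup (handlebodyOpp S' i) (centralInclusion S' i x₀') →* T,
          Φ.comp jA = f ∧ Φ.comp jB = f') ∧
      Function.Surjective a ∧ Function.Surjective b ∧
      (a.ker : Set (FreeGroup (surfaceGen g))) = PresentedGroup.mk _ ⁻¹' (K i : Set (SurfaceGroup g)) ∧
      (b.ker : Set (FreeGroup (surfaceGen 3))) =
        PresentedGroup.mk _ ⁻¹' (s4Kernels i : Set (SurfaceGroup 3)) ∧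
      ((FundamentalGroup.map (centralInclusion S' i) x₀').comp μ'.toMonoidHom).comp
        ((PresentedGroup.mk _).comp (genIncl g)) = jA.comp a ∧
      ((FundamentalGroup.map (centralInclusion S' i) x₀').comp μ'.toMonoidHom).comp
        ((PresentedGroup.mk _).comp (genShift g)) = jB.comp b) :
    groupGKTrisectionOf h' x₀' μ' = K.stabilize := by
  funext i
  obtain ⟨A', B', _, _, jA, jB, a, b, hcop, ha, hb, hka, hkb, hA, hB⟩ := hslot i
  exact groupGKTrisectionOf_apply_eq_stabilize_of_coprod h' x₀' μ' K i jA jB hcop a b ha hb hka hkb hA hB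

/-- **One slot of the geometric half of (c′), from inclusion-level data** (the exact list of
`π₁` inputs the geometric construction has to deliver for the `i`-th kernel).  Notation:
`F ⊇ A = F ∖ D̊` the old central surface minus the disc carrying the modification, `Hᵢ ⊇ A^H`
the old handlebody minus a half-ball, `F′ = A ∪_C P` the new central surface, `H′ᵢ = A^H ∪_E B^H`
the new handlebody (Gay–Kirby, Def. 8), all fundamental groups at a point `c₀` of the seam circle
`C` (`= c₀′` in `F′`); `Γ_A = π₁(A)`, `Γ_{AH} = π₁(A^H)`, `Γ_P = π₁(P)`, `Γ_{BH} = π₁(B^H)` are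
abstract groups and all unnamed maps are induced by inclusions.  Inputs:
* old side — a marking `μ₀` of `F` reading words through `θ_A : F⟨a₁,…,b_g⟩ → Γ_A` and
  `Γ_A → π₁(F)` (`surfaceGroup_exists_mulEquiv_of_basis_of_surjective`); `Γ_A → Γ_{AH}` onto on
  the image of `θ_A`; `Γ_{AH} → π₁(Hᵢ)` injective (a half-ball bite does not change `π₁`) and
  compatible; the new marking `μ′` reads the first `g` handles through the same `θ_A` and
  `Γ_A → π₁(F′)`; `Γ_{AH} → π₁(H′ᵢ)` compatible;
* new side — `μ′` reads the last three handles through `θ_P : F⟨a₁,…,b₃⟩ → Γ_P` and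
  `Γ_P → π₁(F′)`; `Γ_P → Γ_{BH}` onto on the image of `θ_P` with kernel (pulled back to the free
  group) normally generated by the three cut curves `s4Gens i` and the seam circle `r₃` (the
  genus-`3` chunk of the standard picture, Gay–Kirby Fig. 3 / Abrams–Gay–Kirby Fig. 1–2);
  `Γ_{BH} → π₁(H′ᵢ)` compatible;
* `π₁(H′ᵢ)` is the free product of `Γ_{AH}` and `Γ_{BH}` along these two maps (van Kampen across
  the disc `E`).
Conclusion: the `i`-th kernel of `𝒢(h′, c₀′, μ′)` is the `i`-th kernel of `(𝒢(h, c₀, μ₀)).stabilize`.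
[cite: AbramsGayKirby2018, Def. 3 (p. 1540) and Thm. 5 (p. 1541)]
[cite: GayKirby2016, Def. 8 and Lemma 10 (p. 3100)] -/
theorem groupGKTrisectionOf_apply_eq_stabilize_of_pieces
    {k' : Fin 3 → ℕ} {S : Fin 3 → Set X}
    (h : IsGKTrisection X g k S) (c₀ : centralSurface S)
    (μ₀ : SurfaceGroup g ≃* FundamentalGroup (centralSurface S) c₀)
    (h' : IsGKTrisection X (g + 3) k' S') (c₀' : centralSurface S')
    (μ' : SurfaceGroup (g + 3) ≃* FundamentalGroup (centralSurface S') c₀') (i : Fin 3)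
    {ΓA ΓAH ΓP ΓBH : Type*} [Group ΓA] [Group ΓAH] [Group ΓP] [Group ΓBH]
    -- the old side
    (θA : FreeGroup (surfaceGen g) →* ΓA)
    (inclAF : ΓA →* FundamentalGroup (centralSurface S) c₀)
    (hμ₀ : μ₀.toMonoidHom.comp
      (PresentedGroup.mk ({surfaceRelator g} : Set (FreeGroup (surfaceGen g)))) = inclAF.comp θA)
    (ρA : ΓA →* ΓAH) (ha : Function.Surjective (ρA.comp θA))
    (jH : ΓAH →* FundamentalGroup (handlebodyOpp S i) (centralInclusion S i c₀))
    (hjH : Function.Injective jH)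
    (hsqA : jH.comp ρA = (FundamentalGroup.map (centralInclusion S i) c₀).comp inclAF)
    (inclAF' : ΓA →* FundamentalGroup (centralSurface S') c₀')
    (hμ'A : μ'.toMonoidHom.comp ((PresentedGroup.mk _).comp (genIncl g)) = inclAF'.comp θA)
    (jA : ΓAH →* FundamentalGroup (handlebodyOpp S' i) (centralInclusion S' i c₀'))
    (hsqA' : jA.comp ρA = (FundamentalGroup.map (centralInclusion S' i) c₀').comp inclAF')
    -- the new side
    (θP : FreeGroup (surfaceGen 3) →* ΓP)
    (inclPF' : ΓP →* FundamentalGroup (centralSurface S') c₀')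
    (hμ'P : μ'.toMonoidHom.comp ((PresentedGroup.mk _).comp (genShift g)) = inclPF'.comp θP)
    (ρP : ΓP →* ΓBH) (hb : Function.Surjective (ρP.comp θP))
    (hkerP : ((ρP.comp θP).ker : Set (FreeGroup (surfaceGen 3))) =
      (normalClosure (FreeGroup.of '' (s4Gens i : Set (surfaceGen 3)) ∪ {surfaceRelator 3}) :
        Set (FreeGroup (surfaceGen 3))))
    (jB : ΓBH →* FundamentalGroup (handlebodyOpp S' i) (centralInclusion S' i c₀'))
    (hsqP : jB.comp ρP = (FundamentalGroup.map (centralInclusion S' i) c₀').comp inclPF')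
    -- `π₁(H′ᵢ) = π₁(A^H) ∗ π₁(B^H)`
    (hcop : ∀ (T : Type) [Group T] (f : ΓAH →* T) (f' : ΓBH →* T),
      ∃ Φ : FundamentalGroup (handlebodyOpp S' i) (centralInclusion S' i c₀') →* T,
        Φ.comp jA = f ∧ Φ.comp jB = f') :
    groupGKTrisectionOf h' c₀' μ' i = (groupGKTrisectionOf h c₀ μ₀).stabilize i := by
  refine groupGKTrisectionOf_apply_eq_stabilize_of_coprod h' c₀' μ' (groupGKTrisectionOf h c₀ μ₀) i
    jA jB hcop (ρA.comp θA) (ρP.comp θP) ha hb ?_ ?_ ?_ ?_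
  · exact ker_comp_coe_eq_preimage_comap θA inclAF μ₀ hμ₀ _ ρA jH hjH hsqA
  · rw [hkerP, preimage_mk_s4Kernels]
  · refine MonoidHom.ext fun x => ?_
    have e1 := DFunLike.congr_fun hμ'A x
    have e2 := DFunLike.congr_fun hsqA' (θA x)
    simp only [MonoidHom.comp_apply, MulEquiv.coe_toMonoidHom] at e1 e2 ⊢
    rw [e1, e2]
  · refine MonoidHom.ext fun x => ?_
    have e1 := DFunLike.congr_fun hμ'P x
    have e2 := DFunLike.congr_fun hsqP (θP x)
    simp only [MonoidHom.comp_apply, MulEquiv.coe_toMonoidHom] at e1 e2 ⊢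
    rw [e1, e2]

/-- From equality to the `Iso` form used by (c′): if some balanced `(g+3, k+1)`-trisection of `X`
with a marking has kernel triple EQUAL to `K.stabilize`, then a fortiori one with kernel triple
isomorphic to it exists (the shape of `hgeom` in `exists_stabilized_gkTrisection_of_lift`, with
`K = 𝒢(h, x₀, μ₀)`). [cite: AbramsGayKirby2018, Def. 3 (p. 1540) and Thm. 5 (p. 1541)] -/
theorem exists_iso_stabilize_of_eq {g k : ℕ} (K : TrisectionKernels g)
    (heq : ∃ (S' : Fin 3 → Set X) (h' : IsBalancedGKTrisection X (g + 3) (k + 1) S')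
      (x₀' : centralSurface S')
      (μ' : SurfaceGroup (g + 3) ≃* FundamentalGroup (centralSurface S') x₀'),
      groupGKTrisectionOf h' x₀' μ' = K.stabilize) :
    ∃ (S' : Fin 3 → Set X) (h' : IsBalancedGKTrisection X (g + 3) (k + 1) S')
      (x₀' : centralSurface S')
      (μ' : SurfaceGroup (g + 3) ≃* FundamentalGroup (centralSurface S') x₀'),
      TrisectionKernels.Iso (groupGKTrisectionOf h' x₀' μ') K.stabilize := by
  obtain ⟨S', h', x₀', μ', hK⟩ := heq
  exact ⟨S', h', x₀', μ', hK ▸ TrisectionKernels.Iso.refl _⟩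

end Packaging

end Literature.Topology.FourManifolds
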